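/-
Origin: expansion seat `prover-pub-hodgecm-mc-binder-1-g12-0`, handover #58 2026-08-20T11:10:51Z md5 849a3d841db7 (NEW additive KERNEL leaf; imports #57 + vendored JunctionSwapBargmann; drop-alone) (`HOME/mc/pub-hodgecm-mc-binder-1-g12/stage50/HodgeCM/Model/Binders/Real34FollandRename.lean`, md5 849a3d841db7, 79 lines);
landed by the second packager p2 gen 7 (p2-g7) in gate run 50 as `HodgeCM/Model/Binders/Real34FollandRename.lean` (verbatim).
-/
/-
Origin: pub-hodgecm MODEL-CONSTRUCTION sub-cell (Hodge conjecture, CM-per-L package), seat mc-binder-1 gen 12, session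
prover-pub-hodgecm-mc-binder-1-g12-0, 2026-08-20.  Target in PKG: HodgeCM/Model/Binders/Real34FollandRename.lean (NEW additive leaf; imports RUN-49 #57
`Binders/Real34FollandBox` + vendored `KonnoKonno2007/JunctionSwapBargmann`).  KERNEL MATHEMATICS ONLY: no `def … : Prop`, no `axiom`, no proof hole.  Consumer: the archimedean letter identity
`harch` of the row-17 socket (#56 `Binders/Real34Census`), ingredient (ii″) of `mc/pub-hodgecm-mc-binder-1-g12/HARCH-PLAN.md` (frame bookkeeping).
-/
import Summits.HodgeConjecture.HodgeCM.Model.Binders.Real34FollandBox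
import Literature.RepresentationTheory.KonnoKonno2007.JunctionSwapBargmann

/-!
# Row 17 (`real34`), archimedean letters: Folland letters are natural under RE-INDEXING of the frame coordinates

For an equivalence of coordinate index types `π : σ ≃ τ` (symbol level in the vendored tree: `binv_rename`, `relabelCLE`,
`schwartzTransport_relabelCLE_binvPi` of `KonnoKonno2007/JunctionSwapBargmann`), the FRAME-level statements:

* **`follandFock_rename_equiv`**: `follandFock e (rename π F) = follandFock (e.trans (relabelCLE π)⁻¹) F` — renaming the Fock variables of a
  letter is the same letter in the re-indexed frame; `follandFock_eq_rename_equiv` (read backwards), `follandFock_rename_equiv_apply` (pointwise);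
* **`archBoxTensor_follandFock_relabel`**: with #57, `follandFock e₁ F ⊠ follandFock e₂ G = follandFock ((sumFrame e₁ e₂).trans (relabelCLE π))
  (rename π (F(z_inl) G(z_inr)))` for any `π : σ₁ ⊕ σ₂ ≃ σ` — the shape in which a `Fin 6`-frame letter (the census side of `harch`) is compared with a
  box tensor of two `Fin 3`-frame letters (the line side).

## References
* [Folland1989] G. B. Folland, *Harmonic Analysis in Phase Space*, Princeton UP (1989), §1.7 (1.78)–(1.81).
-/

set_option autoImplicit false

noncomputable section

open NumberField NumberField.mixedEmbedding MvPolynomial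
open Literature.Analysis.SegalBargmann Literature.NumberTheory.Weil1964 Literature.NumberTheory.Automorphic

namespace HodgeCM.Model

open scoped Classical

variable {σ τ : Type*} [Fintype σ] [Fintype τ] [DecidableEq σ] [DecidableEq τ]
variable {K : Type} [Field K] [NumberField K] {ι : Type} [Fintype ι]

/-- **Folland letters are natural under re-indexing of the frame**: `follandFock e (rename π F) = follandFock (e.trans (relabelCLE π)⁻¹) F`
(`relabelCLE π : ℝ^σ ≃L ℝ^τ`, `y ↦ y ∘ π⁻¹`, vendored `KonnoKonno2007/JunctionSwapBargmann`; its `binv_rename` is the symbol-level statement).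
[cite: Folland1989, §1.7 (1.81)] -/
theorem follandFock_rename_equiv (π : σ ≃ τ) (e : (ι → mixedSpace K) ≃L[ℝ] (τ → ℝ)) (F : MvPolynomial σ ℂ) :
    follandFock e (rename π F) = follandFock (e.trans (relabelCLE π).symm) F := by
  ext x
  rw [follandFock_apply, follandFock_apply, ← schwartzTransport_relabelCLE_binvPi, schwartzTransport_apply]
  rfl

/-- The same read from the `σ`-frame: `follandFock e F = follandFock (e.trans (relabelCLE π)) (rename π F)` — a letter in the frame `e` is the
renamed letter in the re-indexed frame. [cite: Folland1989, §1.7 (1.81)] -/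
theorem follandFock_eq_rename_equiv (π : σ ≃ τ) (e : (ι → mixedSpace K) ≃L[ℝ] (σ → ℝ)) (F : MvPolynomial σ ℂ) :
    follandFock e F = follandFock (e.trans (relabelCLE π)) (rename π F) := by
  rw [follandFock_rename_equiv]
  congr 1
  ext x s
  simp only [ContinuousLinearEquiv.trans_apply, relabelCLE_symm_apply, relabelCLE_apply, Equiv.symm_apply_apply]

/-- Pointwise form: `follandFock e (rename π F) x = (B⁻¹ F) ((e x) ∘ π)`. [cite: Folland1989, §1.7 (1.81)] -/
theorem follandFock_rename_equiv_apply (π : σ ≃ τ) (e : (ι → mixedSpace K) ≃L[ℝ] (τ → ℝ)) (F : MvPolynomial σ ℂ)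
    (x : ι → mixedSpace K) :
    follandFock e (rename π F) x = (binvPi F : SchwartzMap (σ → ℝ) ℂ) ((e x) ∘ π) := by
  rw [follandFock_rename_equiv, follandFock_apply]
  rfl

variable {ι₁ ι₂ : Type} [Fintype ι₁] [Fintype ι₂] {σ₁ σ₂ : Type*} [Fintype σ₁] [Fintype σ₂] [DecidableEq σ₁] [DecidableEq σ₂]

/-- **Box tensor of Folland letters in a re-indexed sum frame**: for `π : σ₁ ⊕ σ₂ ≃ σ`,
`follandFock e₁ F ⊠ follandFock e₂ G = follandFock ((sumFrame e₁ e₂).trans (relabelCLE π)) (rename π (F(z_inl) · G(z_inr)))` — the form in which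
a letter of a frame indexed by `σ` (e.g. `Fin 6`) is compared with a box tensor of letters indexed by `σ₁`, `σ₂` (e.g. `Fin 3`, `Fin 3`).
[cite: Folland1989, §1.6–§1.7] -/
theorem archBoxTensor_follandFock_relabel (π : σ₁ ⊕ σ₂ ≃ σ) (e₁ : (ι₁ → mixedSpace K) ≃L[ℝ] (σ₁ → ℝ))
    (e₂ : (ι₂ → mixedSpace K) ≃L[ℝ] (σ₂ → ℝ)) (F : MvPolynomial σ₁ ℂ) (G : MvPolynomial σ₂ ℂ) :
    archBoxTensor (follandFock e₁ F) (follandFock e₂ G) =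
      follandFock ((sumFrame e₁ e₂).trans (relabelCLE π)) (rename π (rename Sum.inl F * rename Sum.inr G)) := by
  rw [archBoxTensor_follandFock, ← follandFock_eq_rename_equiv]

end HodgeCM.Model

end
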